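import Summits.Ventures.LatticeQCDFlow.Scoring.UNNestedWilsonLoopCovariance2D
import Summits.Ventures.LatticeQCDFlow.Scoring.UNNestedWilsonLoopTraceProduct2D
import HarnessLib

/-!
# The exact REAL covariance input of two nested two-dimensional `U(N)` Wilson loops: `⟨Re tr W_{R×T} · Re tr W_{R'×T}⟩_β` in closed form

HONEST FRAMING: exact (Metropolis-corrected) sampling algorithms for lattice gauge theory;
figures of merit are autocorrelation/cost numbers at stated couplings and volumes; no
continuum-physics claim.

Venture `LatticeQCDFlow` (cell pub-lqcd), sub-topic `Scoring`; FANOUT row 5 (`s0-sun-a`), GEN-21.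
NEW WORK of the cell (placement rule).  The measured observables are the REAL traces `Re tr W_{R×T}`; for two NESTED
loops `W = W_{(R'+k)×T}`, `W' = W_{R'×T}` (common corner and height; free-boundary `U(N)` lattice Yang–Mills in two
dimensions, `N ≥ 2`, every real `β`, `R' + k + 1 ≤ L`, `T + 1 ≤ L`) the identity `Re z · Re w = ½ Re(z·w̄ + z·w)` and
GEN-21's two nested channel moments — `⟨tr W · conj tr W'⟩ = P_N^{kT}(1 + (N²−1)P_adj^{R'T})`
(`UNNestedWilsonLoopCovariance2D`) and `⟨tr W · tr W'⟩ = P_N^{kT}(d_S P_S^{R'T} + d_A P_A^{R'T})`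
(`UNNestedWilsonLoopTraceProduct2D`) — give

  **`⟨Re tr W · Re tr W'⟩_β = ½·Re( P_N^{kT}(1 + (N²−1)P_adj^{R'T}) + P_N^{kT}(d_S P_S^{R'T} + d_A P_A^{R'T}) )`**

(`unitary_open_re_trace_mul_re_trace_nested_eq`); subtracting the product of the means `N²·P_N^{(2R'+k)T}` (GEN-18's
area law) is the exact covariance of the two measured loops — the error-propagation input of Creutz ratios
`χ = −log(W_{R×T}W_{R'×T'}/(W_{R×T'}W_{R'×T}))` for loops sharing a corner and a side.  Every one-plaquette quantity
(`P_N`, `P_adj`, `P_S`, `P_A` via `D = det[I_{|i−j|}(β)]`, `M₂`, `s₁`, `s₂`) is an explicit `U(N)` integral.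

No `def`, nothing cited as a fact, 0 sorry.
-/

noncomputable section

open MeasureTheory Function Finset
open Literature.MathematicalPhysics.QuantumFieldTheory
open Literature.MathematicalPhysics.QuantumLattice
open Summit.Ventures.LatticeQCDFlow.Theory2.Lattice
open Summit.Ventures.LatticeQCDFlow.Theory2.Lattice.TwoDim
open Literature.Analysis.FunctionSpaces (besselI)

namespace Summit.Ventures.LatticeQCDFlow.Scoring

section Nested

variable {L : ℕ} [NeZero L] {N : ℕ}

/-- **`⟨Re tr W_{(R'+k)×T} · Re tr W_{R'×T}⟩_β` IN CLOSED FORM** (`U(N)`, `N ≥ 2`, every real `β`, nested loops with common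
corner and height): `= ½·Re(⟨tr W conj tr W'⟩ + ⟨tr W tr W'⟩)` with both channel moments exact (GEN-21). -/
theorem unitary_open_re_trace_mul_re_trace_nested_eq (hN : 2 ≤ N) (β : ℝ) (i j : ZMod L) {R' k T : ℕ}
    (hR : R' + k + 1 ≤ L) (hT : T + 1 ≤ L) :
    (∫ U, ((rectangleHolonomy U ![i, j] 0 1 (R' + k) T : Matrix.unitaryGroup (Fin N) ℂ) : Matrix (Fin N) (Fin N) ℂ).trace.re *
        ((rectangleHolonomy U ![i, j] 0 1 R' T : Matrix.unitaryGroup (Fin N) ℂ) : Matrix (Fin N) (Fin N) ℂ).trace.re *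
        ∏ p ∈ (range (R' + k) ×ˢ range T).image (fun q : ℕ × ℕ => (![i + q.1, j + q.2] : Site 2 L)),
          Real.exp (-(β * ((N : ℝ) - ((plaquetteHolonomy U p 0 1 : Matrix.unitaryGroup (Fin N) ℂ) :
            Matrix (Fin N) (Fin N) ℂ).trace.re)))
        ∂(Measure.pi fun _ : Edge 2 L => haarProbability (Matrix.unitaryGroup (Fin N) ℂ))) /
      (∫ U, ∏ p ∈ (range (R' + k) ×ˢ range T).image (fun q : ℕ × ℕ => (![i + q.1, j + q.2] : Site 2 L)),
          Real.exp (-(β * ((N : ℝ) - ((plaquetteHolonomy U p 0 1 : Matrix.unitaryGroup (Fin N) ℂ) :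
            Matrix (Fin N) (Fin N) ℂ).trace.re)))
        ∂(Measure.pi fun _ : Edge 2 L => haarProbability (Matrix.unitaryGroup (Fin N) ℂ))) =
      ((((((N : ℝ)⁻¹ * ∫ u, ((u : Matrix.unitaryGroup (Fin N) ℂ) : Matrix (Fin N) (Fin N) ℂ).trace.re *
          Real.exp (-(β * ((N : ℝ) - ((u : Matrix.unitaryGroup (Fin N) ℂ) : Matrix (Fin N) (Fin N) ℂ).trace.re)))
          ∂(haarProbability (Matrix.unitaryGroup (Fin N) ℂ))) /
          (∫ u, Real.exp (-(β * ((N : ℝ) - ((u : Matrix.unitaryGroup (Fin N) ℂ) : Matrix (Fin N) (Fin N) ℂ).trace.re)))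
            ∂(haarProbability (Matrix.unitaryGroup (Fin N) ℂ))) : ℝ) : ℂ) ^ (k * T) *
        (1 + ((N : ℂ) ^ 2 - 1) *
          ((((∫ u, (‖((u : Matrix.unitaryGroup (Fin N) ℂ) : Matrix (Fin N) (Fin N) ℂ).trace‖ ^ 2 : ℝ) *
              Real.exp (β * ((u : Matrix.unitaryGroup (Fin N) ℂ) : Matrix (Fin N) (Fin N) ℂ).trace.re)
              ∂(haarProbability (Matrix.unitaryGroup (Fin N) ℂ))) /
              (Matrix.of fun i j : Fin N => besselI ((i : ℤ) - (j : ℤ)).natAbs β).det - 1) / ((N : ℝ) ^ 2 - 1) : ℝ) : ℂ) ^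
            (R' * T))) +
      (((((N : ℝ)⁻¹ * ∫ u, ((u : Matrix.unitaryGroup (Fin N) ℂ) : Matrix (Fin N) (Fin N) ℂ).trace.re *
          Real.exp (-(β * ((N : ℝ) - ((u : Matrix.unitaryGroup (Fin N) ℂ) : Matrix (Fin N) (Fin N) ℂ).trace.re)))
          ∂(haarProbability (Matrix.unitaryGroup (Fin N) ℂ))) /
          (∫ u, Real.exp (-(β * ((N : ℝ) - ((u : Matrix.unitaryGroup (Fin N) ℂ) : Matrix (Fin N) (Fin N) ℂ).trace.re)))
            ∂(haarProbability (Matrix.unitaryGroup (Fin N) ℂ))) : ℝ) : ℂ) ^ (k * T) *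
        (((N : ℂ) * (N + 1) / 2) *
            (((∫ u, ((u : Matrix.unitaryGroup (Fin N) ℂ) : Matrix (Fin N) (Fin N) ℂ).trace ^ 2 *
                (Real.exp (β * ((u : Matrix.unitaryGroup (Fin N) ℂ) : Matrix (Fin N) (Fin N) ℂ).trace.re) : ℂ)
                ∂(haarProbability (Matrix.unitaryGroup (Fin N) ℂ))) +
              (∫ u, (((u : Matrix.unitaryGroup (Fin N) ℂ) : Matrix (Fin N) (Fin N) ℂ) *
                ((u : Matrix.unitaryGroup (Fin N) ℂ) : Matrix (Fin N) (Fin N) ℂ)).trace *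
                (Real.exp (β * ((u : Matrix.unitaryGroup (Fin N) ℂ) : Matrix (Fin N) (Fin N) ℂ).trace.re) : ℂ)
                ∂(haarProbability (Matrix.unitaryGroup (Fin N) ℂ)))) /
              (N * (N + 1) * (((Matrix.of fun i j : Fin N => besselI ((i : ℤ) - (j : ℤ)).natAbs β).det : ℝ) : ℂ))) ^ (R' * T) +
          ((N : ℂ) * (N - 1) / 2) *
            (((∫ u, ((u : Matrix.unitaryGroup (Fin N) ℂ) : Matrix (Fin N) (Fin N) ℂ).trace ^ 2 *
                (Real.exp (β * ((u : Matrix.unitaryGroup (Fin N) ℂ) : Matrix (Fin N) (Fin N) ℂ).trace.re) : ℂ)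
                ∂(haarProbability (Matrix.unitaryGroup (Fin N) ℂ))) -
              (∫ u, (((u : Matrix.unitaryGroup (Fin N) ℂ) : Matrix (Fin N) (Fin N) ℂ) *
                ((u : Matrix.unitaryGroup (Fin N) ℂ) : Matrix (Fin N) (Fin N) ℂ)).trace *
                (Real.exp (β * ((u : Matrix.unitaryGroup (Fin N) ℂ) : Matrix (Fin N) (Fin N) ℂ).trace.re) : ℂ)
                ∂(haarProbability (Matrix.unitaryGroup (Fin N) ℂ)))) /
              (N * (N - 1) * (((Matrix.of fun i j : Fin N => besselI ((i : ℤ) - (j : ℤ)).natAbs β).det : ℝ) : ℂ))) ^ (R' * T)))).re / 2 := by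
  -- the two GEN-21 channel moments (stated before the abbreviations so that `set` rewrites them too)
  have h1 := unitary_open_trace_mul_conj_trace_nested_eq (L := L) hN β i j hR hT
  have h2 := unitary_open_trace_mul_trace_nested_eq (L := L) hN β i j hR hT
  have hZ := unitary_open_partitionFunction_eq (L := L) N β i j hR hT
  -- abbreviations
  set μ := (Measure.pi fun _ : Edge 2 L => haarProbability (Matrix.unitaryGroup (Fin N) ℂ)) with hμ
  set Z : ℝ := ∫ U, ∏ p ∈ (range (R' + k) ×ˢ range T).image (fun q : ℕ × ℕ => (![i + q.1, j + q.2] : Site 2 L)),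
          Real.exp (-(β * ((N : ℝ) - ((plaquetteHolonomy U p 0 1 : Matrix.unitaryGroup (Fin N) ℂ) :
            Matrix (Fin N) (Fin N) ℂ).trace.re))) ∂μ with hZdef
  set A : ℂ := ((((N : ℝ)⁻¹ * ∫ u, ((u : Matrix.unitaryGroup (Fin N) ℂ) : Matrix (Fin N) (Fin N) ℂ).trace.re *
          Real.exp (-(β * ((N : ℝ) - ((u : Matrix.unitaryGroup (Fin N) ℂ) : Matrix (Fin N) (Fin N) ℂ).trace.re)))
          ∂(haarProbability (Matrix.unitaryGroup (Fin N) ℂ))) /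
          (∫ u, Real.exp (-(β * ((N : ℝ) - ((u : Matrix.unitaryGroup (Fin N) ℂ) : Matrix (Fin N) (Fin N) ℂ).trace.re)))
            ∂(haarProbability (Matrix.unitaryGroup (Fin N) ℂ))) : ℝ) : ℂ) ^ (k * T) *
        (1 + ((N : ℂ) ^ 2 - 1) *
          ((((∫ u, (‖((u : Matrix.unitaryGroup (Fin N) ℂ) : Matrix (Fin N) (Fin N) ℂ).trace‖ ^ 2 : ℝ) *
              Real.exp (β * ((u : Matrix.unitaryGroup (Fin N) ℂ) : Matrix (Fin N) (Fin N) ℂ).trace.re)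
              ∂(haarProbability (Matrix.unitaryGroup (Fin N) ℂ))) /
              (Matrix.of fun i j : Fin N => besselI ((i : ℤ) - (j : ℤ)).natAbs β).det - 1) / ((N : ℝ) ^ 2 - 1) : ℝ) : ℂ) ^
            (R' * T)) with hA
  set B : ℂ := ((((N : ℝ)⁻¹ * ∫ u, ((u : Matrix.unitaryGroup (Fin N) ℂ) : Matrix (Fin N) (Fin N) ℂ).trace.re *
          Real.exp (-(β * ((N : ℝ) - ((u : Matrix.unitaryGroup (Fin N) ℂ) : Matrix (Fin N) (Fin N) ℂ).trace.re)))
          ∂(haarProbability (Matrix.unitaryGroup (Fin N) ℂ))) /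
          (∫ u, Real.exp (-(β * ((N : ℝ) - ((u : Matrix.unitaryGroup (Fin N) ℂ) : Matrix (Fin N) (Fin N) ℂ).trace.re)))
            ∂(haarProbability (Matrix.unitaryGroup (Fin N) ℂ))) : ℝ) : ℂ) ^ (k * T) *
        (((N : ℂ) * (N + 1) / 2) *
            (((∫ u, ((u : Matrix.unitaryGroup (Fin N) ℂ) : Matrix (Fin N) (Fin N) ℂ).trace ^ 2 *
                (Real.exp (β * ((u : Matrix.unitaryGroup (Fin N) ℂ) : Matrix (Fin N) (Fin N) ℂ).trace.re) : ℂ)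
                ∂(haarProbability (Matrix.unitaryGroup (Fin N) ℂ))) +
              (∫ u, (((u : Matrix.unitaryGroup (Fin N) ℂ) : Matrix (Fin N) (Fin N) ℂ) *
                ((u : Matrix.unitaryGroup (Fin N) ℂ) : Matrix (Fin N) (Fin N) ℂ)).trace *
                (Real.exp (β * ((u : Matrix.unitaryGroup (Fin N) ℂ) : Matrix (Fin N) (Fin N) ℂ).trace.re) : ℂ)
                ∂(haarProbability (Matrix.unitaryGroup (Fin N) ℂ)))) /
              (N * (N + 1) * (((Matrix.of fun i j : Fin N => besselI ((i : ℤ) - (j : ℤ)).natAbs β).det : ℝ) : ℂ))) ^ (R' * T) +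
          ((N : ℂ) * (N - 1) / 2) *
            (((∫ u, ((u : Matrix.unitaryGroup (Fin N) ℂ) : Matrix (Fin N) (Fin N) ℂ).trace ^ 2 *
                (Real.exp (β * ((u : Matrix.unitaryGroup (Fin N) ℂ) : Matrix (Fin N) (Fin N) ℂ).trace.re) : ℂ)
                ∂(haarProbability (Matrix.unitaryGroup (Fin N) ℂ))) -
              (∫ u, (((u : Matrix.unitaryGroup (Fin N) ℂ) : Matrix (Fin N) (Fin N) ℂ) *
                ((u : Matrix.unitaryGroup (Fin N) ℂ) : Matrix (Fin N) (Fin N) ℂ)).trace *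
                (Real.exp (β * ((u : Matrix.unitaryGroup (Fin N) ℂ) : Matrix (Fin N) (Fin N) ℂ).trace.re) : ℂ)
                ∂(haarProbability (Matrix.unitaryGroup (Fin N) ℂ)))) /
              (N * (N - 1) * (((Matrix.of fun i j : Fin N => besselI ((i : ℤ) - (j : ℤ)).natAbs β).det : ℝ) : ℂ))) ^ (R' * T)) with hB
  have hFc : ∀ R₀ : ℕ, Continuous fun U : GaugeConfig 2 L (Matrix.unitaryGroup (Fin N) ℂ) =>
      ((rectangleHolonomy U ![i, j] 0 1 R₀ T : Matrix.unitaryGroup (Fin N) ℂ) : Matrix (Fin N) (Fin N) ℂ).trace := fun R₀ =>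
    (continuous_unitaryFundamentalRep (Fin N) ℂ).matrix_trace.comp (continuous_config_rectangleHolonomy _ 0 1 R₀ T)
  have hwc : ∀ p : Site 2 L, Continuous fun U : GaugeConfig 2 L (Matrix.unitaryGroup (Fin N) ℂ) =>
      Real.exp (-(β * ((N : ℝ) - ((plaquetteHolonomy U p 0 1 : Matrix.unitaryGroup (Fin N) ℂ) :
        Matrix (Fin N) (Fin N) ℂ).trace.re))) := fun p =>
    Real.continuous_exp.comp ((continuous_const.mul (continuous_const.sub (Complex.continuous_re.comp
      ((continuous_unitaryFundamentalRep (Fin N) ℂ).matrix_trace.comp (continuous_config_plaquetteHolonomy p 0 1))))).neg)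
  have hΨc : Continuous fun U : GaugeConfig 2 L (Matrix.unitaryGroup (Fin N) ℂ) =>
      ∏ p ∈ (range (R' + k) ×ˢ range T).image (fun q : ℕ × ℕ => (![i + q.1, j + q.2] : Site 2 L)),
          Real.exp (-(β * ((N : ℝ) - ((plaquetteHolonomy U p 0 1 : Matrix.unitaryGroup (Fin N) ℂ) :
            Matrix (Fin N) (Fin N) ℂ).trace.re))) := continuous_finsetProd _ fun p _ => hwc p
  have hΨc' : Continuous fun U : GaugeConfig 2 L (Matrix.unitaryGroup (Fin N) ℂ) =>
      ∏ p ∈ (range (R' + k) ×ˢ range T).image (fun q : ℕ × ℕ => (![i + q.1, j + q.2] : Site 2 L)),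
          (Real.exp (-(β * ((N : ℝ) - ((plaquetteHolonomy U p 0 1 : Matrix.unitaryGroup (Fin N) ℂ) :
            Matrix (Fin N) (Fin N) ℂ).trace.re))) : ℂ) := continuous_finsetProd _ fun p _ => Complex.continuous_ofReal.comp (hwc p)
  -- positivity of the partition function
  have hZpos : 0 < Z := by
    rw [hZ]; exact pow_pos (mul_pos (Real.exp_pos _) (det_besselI_toeplitz_fin_pos N β)) _
  have hZc : (Z : ℂ) ≠ 0 := by exact_mod_cast hZpos.ne'
  -- clear denominators in the two moments
  have e1 := (div_eq_iff hZc).1 h1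
  have e2 := (div_eq_iff hZc).1 h2
  -- integrability of the two complex integrands and of their real parts
  have hI1c : Integrable (fun U => ((rectangleHolonomy U ![i, j] 0 1 (R' + k) T : Matrix.unitaryGroup (Fin N) ℂ) : Matrix (Fin N) (Fin N) ℂ).trace *
      (starRingEnd ℂ) ((rectangleHolonomy U ![i, j] 0 1 R' T : Matrix.unitaryGroup (Fin N) ℂ) : Matrix (Fin N) (Fin N) ℂ).trace *
      ∏ p ∈ (range (R' + k) ×ˢ range T).image (fun q : ℕ × ℕ => (![i + q.1, j + q.2] : Site 2 L)),
          (Real.exp (-(β * ((N : ℝ) - ((plaquetteHolonomy U p 0 1 : Matrix.unitaryGroup (Fin N) ℂ) :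
            Matrix (Fin N) (Fin N) ℂ).trace.re))) : ℂ)) μ :=
    integrable_gaugeConfig_of_continuous (((hFc (R' + k)).mul (Complex.continuous_conj.comp (hFc R'))).mul hΨc')
  have hI2c : Integrable (fun U => ((rectangleHolonomy U ![i, j] 0 1 (R' + k) T : Matrix.unitaryGroup (Fin N) ℂ) : Matrix (Fin N) (Fin N) ℂ).trace *
      ((rectangleHolonomy U ![i, j] 0 1 R' T : Matrix.unitaryGroup (Fin N) ℂ) : Matrix (Fin N) (Fin N) ℂ).trace *
      ∏ p ∈ (range (R' + k) ×ˢ range T).image (fun q : ℕ × ℕ => (![i + q.1, j + q.2] : Site 2 L)),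
          (Real.exp (-(β * ((N : ℝ) - ((plaquetteHolonomy U p 0 1 : Matrix.unitaryGroup (Fin N) ℂ) :
            Matrix (Fin N) (Fin N) ℂ).trace.re))) : ℂ)) μ :=
    integrable_gaugeConfig_of_continuous (((hFc (R' + k)).mul (hFc R')).mul hΨc')
  have hI1 : Integrable (fun U => (((rectangleHolonomy U ![i, j] 0 1 (R' + k) T : Matrix.unitaryGroup (Fin N) ℂ) : Matrix (Fin N) (Fin N) ℂ).trace *
      (starRingEnd ℂ) ((rectangleHolonomy U ![i, j] 0 1 R' T : Matrix.unitaryGroup (Fin N) ℂ) : Matrix (Fin N) (Fin N) ℂ).trace *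
      ∏ p ∈ (range (R' + k) ×ˢ range T).image (fun q : ℕ × ℕ => (![i + q.1, j + q.2] : Site 2 L)),
          (Real.exp (-(β * ((N : ℝ) - ((plaquetteHolonomy U p 0 1 : Matrix.unitaryGroup (Fin N) ℂ) :
            Matrix (Fin N) (Fin N) ℂ).trace.re))) : ℂ)).re) μ :=
    integrable_gaugeConfig_of_continuous (Complex.continuous_re.comp ((((hFc (R' + k)).mul (Complex.continuous_conj.comp (hFc R'))).mul hΨc')))
  have hI2 : Integrable (fun U => (((rectangleHolonomy U ![i, j] 0 1 (R' + k) T : Matrix.unitaryGroup (Fin N) ℂ) : Matrix (Fin N) (Fin N) ℂ).trace *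
      ((rectangleHolonomy U ![i, j] 0 1 R' T : Matrix.unitaryGroup (Fin N) ℂ) : Matrix (Fin N) (Fin N) ℂ).trace *
      ∏ p ∈ (range (R' + k) ×ˢ range T).image (fun q : ℕ × ℕ => (![i + q.1, j + q.2] : Site 2 L)),
          (Real.exp (-(β * ((N : ℝ) - ((plaquetteHolonomy U p 0 1 : Matrix.unitaryGroup (Fin N) ℂ) :
            Matrix (Fin N) (Fin N) ℂ).trace.re))) : ℂ)).re) μ :=
    integrable_gaugeConfig_of_continuous (Complex.continuous_re.comp (((hFc (R' + k)).mul (hFc R')).mul hΨc'))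
  -- pointwise split `Re F · Re G · Ψ = (Re(F·conj G·Ψ) + Re(F·G·Ψ))/2`
  have hpt : ∀ U : GaugeConfig 2 L (Matrix.unitaryGroup (Fin N) ℂ),
      ((rectangleHolonomy U ![i, j] 0 1 (R' + k) T : Matrix.unitaryGroup (Fin N) ℂ) : Matrix (Fin N) (Fin N) ℂ).trace.re *
        ((rectangleHolonomy U ![i, j] 0 1 R' T : Matrix.unitaryGroup (Fin N) ℂ) : Matrix (Fin N) (Fin N) ℂ).trace.re *
        ∏ p ∈ (range (R' + k) ×ˢ range T).image (fun q : ℕ × ℕ => (![i + q.1, j + q.2] : Site 2 L)),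
          Real.exp (-(β * ((N : ℝ) - ((plaquetteHolonomy U p 0 1 : Matrix.unitaryGroup (Fin N) ℂ) :
            Matrix (Fin N) (Fin N) ℂ).trace.re))) =
      ((((rectangleHolonomy U ![i, j] 0 1 (R' + k) T : Matrix.unitaryGroup (Fin N) ℂ) : Matrix (Fin N) (Fin N) ℂ).trace *
        (starRingEnd ℂ) ((rectangleHolonomy U ![i, j] 0 1 R' T : Matrix.unitaryGroup (Fin N) ℂ) : Matrix (Fin N) (Fin N) ℂ).trace *
        ∏ p ∈ (range (R' + k) ×ˢ range T).image (fun q : ℕ × ℕ => (![i + q.1, j + q.2] : Site 2 L)),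
          (Real.exp (-(β * ((N : ℝ) - ((plaquetteHolonomy U p 0 1 : Matrix.unitaryGroup (Fin N) ℂ) :
            Matrix (Fin N) (Fin N) ℂ).trace.re))) : ℂ)).re +
      (((rectangleHolonomy U ![i, j] 0 1 (R' + k) T : Matrix.unitaryGroup (Fin N) ℂ) : Matrix (Fin N) (Fin N) ℂ).trace *
        ((rectangleHolonomy U ![i, j] 0 1 R' T : Matrix.unitaryGroup (Fin N) ℂ) : Matrix (Fin N) (Fin N) ℂ).trace *
        ∏ p ∈ (range (R' + k) ×ˢ range T).image (fun q : ℕ × ℕ => (![i + q.1, j + q.2] : Site 2 L)),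
          (Real.exp (-(β * ((N : ℝ) - ((plaquetteHolonomy U p 0 1 : Matrix.unitaryGroup (Fin N) ℂ) :
            Matrix (Fin N) (Fin N) ℂ).trace.re))) : ℂ)).re) / 2 := by
    intro U
    have hzw : ∀ z w : ℂ, z.re * w.re = ((z * (starRingEnd ℂ) w).re + (z * w).re) / 2 := fun z w => by
      simp only [Complex.mul_re, Complex.conj_re, Complex.conj_im]; ring
    rw [← Complex.ofReal_prod, Complex.re_mul_ofReal, Complex.re_mul_ofReal, hzw]
    ring
  have hre1 := integral_re hI1c
  have hre2 := integral_re hI2c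
  simp only [RCLike.re_to_complex] at hre1 hre2
  simp_rw [hpt]
  rw [integral_div, integral_add hI1 hI2, hre1, hre2, e1, e2, Complex.re_mul_ofReal, Complex.re_mul_ofReal,
    Complex.add_re]
  field_simp

end Nested

end Summit.Ventures.LatticeQCDFlow.Scoring
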